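import Summits.Ventures.LatticeQCDFlow.TrivializingMaps.WilsonZeroFreeKP
import Summits.Ventures.LatticeQCDFlow.TrivializingMaps.FisherStaircaseCumulants
import Summits.Ventures.LatticeQCDFlow.TrivializingMaps.FisherZeroNearCouplingSharp
import Summits.Ventures.LatticeQCDFlow.TrivializingMaps.WilsonVarianceExtensive
import Literature.MathematicalPhysics.QuantumFieldTheory.PlaqSystemLogZAnalytic
import Literature.Analysis.Complex.CauchyTaylorBall

/-!
HONEST FRAMING: exact (Metropolis-corrected) sampling algorithms for lattice gauge theory; figures
of merit are autocorrelation/cost numbers at stated couplings and volumes; no continuum-physics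
claim.

# StrongCouplingSpecificHeat — VOLUME-UNIFORM TWO-SIDED BOUNDS FOR THE SPECIFIC HEAT PER PLAQUETTE
# OF THE `SU(n)` WILSON THEORY AT STRONG COUPLING, AND FISHER ZEROS NEAR EVERY STRONG-COUPLING POINT
# (lean-2 GEN-8, ours)

Venture-side (OURS).  Cell `lqcd-flow` (pub-lqcd), unit `pub-lqcd-lean-2-g8`, 2026-08-22.

Part T18 bounds the distance from a real coupling `x` to the nearest Fisher zero of `Z_L` by
`4n·#plaq / Var_x(S_W)` — explicit only where the specific heat per plaquette `Var_x(S_W)/#plaq` is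
bounded below uniformly in the volume; the tree had this only at `x = 0`
(`WilsonVarianceExtensive`: `Var_0 = m₂(n)·#plaq`).  Here, with the closed-form Kotecký–Preiss radius
`r = r(d, n) = 1/(8e·n·(3^d d² + 1)²)` of `WilsonZeroFreeKP`:

* §1 `card_torusGenuine`, `wilsonMeasure_zero_eq_trivialMeasure`, and the holomorphic logarithm
  `F = log Z_L` of the torus plaquette system on `|s| < r` (`PlaqSystemLogZAnalytic`): `exp F = Z_L`,
  `‖F‖ ≤ #plaq` (Kotecký–Preiss), `F′ = Z_L′/Z_L`, and `F″(t) = Var_t(S_W)` at real `t`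
  (`FisherStaircaseCumulants.deriv_logDeriv_actionZ_ofReal_eq_variance`);
* §2 **`wilson_variance_sub_le_strongCoupling`** — Cauchy's inequality for `F″` on balls of radius
  `r/2` and the resulting Lipschitz bound (`CauchyTaylorBall`): for every `d`, `n ≥ 2`, EVERY `L ≥ 2`
  and every real `x` with `|x| < r/4`,
  `|Var_x(S_W) − m₂(n)·#plaq| ≤ 256 · #plaq · |x| / r³`
  — the specific heat per plaquette is `m₂(n) + O(|x|)` UNIFORMLY IN THE VOLUME, with a closed-form
  constant; **`wilson_variance_le_strongCoupling`**: `Var_x(S_W) ≤ 32·#plaq / r²` for `|x| < r/2`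
  (no volume-divergence of the specific heat at strong coupling — Osterwalder–Seiler analyticity,
  quantified);
* §3 **`wilson_variance_ge_half_strongCoupling`** — for `|x| ≤ min (r/8) (m₂(n) r³/512)`:
  `Var_x(S_W) ≥ m₂(n)·#plaq / 2`, hence (T18) **`wilson_infDist_zeroSet_le_strongCoupling`**: for
  `d ≥ 2` and every such `x`, EVERY `L ≥ 2`: `dist(x, F_{Z_L}) ≤ 8n / m₂(n)` (`= 16` for `SU(2)`,
  `16n` for `n ≥ 3`) — a Fisher zero within a fixed distance of every strong-coupling point, in every
  volume.

NOT CLAIMED: anything at `|x| ≥ r/4` (in particular near any bulk / deconfinement coupling); sharpness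
of `256`, `32`, `8n/m₂(n)`; `L = 1`; cost / autocorrelation / continuum statements.  Literature grade
(cell rule): known mechanism (finite-volume analyticity of the free energy at strong coupling,
[OsterwalderSeilerAnnPhys1978] Thm. 3.7, [KoteckyPreiss1986]; Cauchy estimates); new typing with
closed-form constants, no new theorem of physics.
-/

noncomputable section

open MeasureTheory ProbabilityTheory Complex Metric Set Filter Topology
open Literature.MathematicalPhysics.QuantumFieldTheory
open Literature.MathematicalPhysics.QuantumFieldTheory.Luscher2010
open Literature.MathematicalPhysics.QuantumFieldTheory.WilsonFlow (coeConfig continuous_coeConfig)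
open Literature.Probability.LatticeModels
open Literature.Analysis.Complex
open scoped Matrix Matrix.Norms.Frobenius ContDiff

namespace Summit.Ventures.LatticeQCDFlow.TrivializingMaps

/-! ## §1 Bookkeeping: plaquette count, the β = 0 measure, the holomorphic logarithm -/

section Bookkeeping

variable {d L N : ℕ} [NeZero L] {G : Type*} [Group G]

/-- The genuine torus plaquette labels are in bijection with Wave 0's plaquettes:
`#torusGenuine = #Plaquette d L`. [folklore] -/
theorem card_torusGenuine : (torusGenuine d L).card = Fintype.card (Plaquette d L) := by
  rw [← Fintype.card_coe]
  refine Fintype.card_congr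
    { toFun := fun q => (q.1.1, ⟨(q.1.2.1, q.1.2.2), (mem_torusGenuine.1 q.2)⟩)
      invFun := fun P => ⟨(P.1, P.2.1.1, P.2.1.2), mem_torusGenuine.2 P.2.2⟩
      left_inv := fun q => by rfl
      right_inv := fun P => by rfl }

variable [TopologicalSpace G] [IsTopologicalGroup G] [CompactSpace G] [MeasurableSpace G]
  [BorelSpace G] (ρ : G →* Matrix (Fin N) (Fin N) ℂ)

/-- At `β = 0` Wave 0's Wilson measure is the trivial theory: `wilsonMeasure ρ 0 = D[U]`. [folklore] -/
theorem wilsonMeasure_zero_eq_trivialMeasure :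
    wilsonMeasure (d := d) (L := L) ρ 0 = trivialMeasure G d L := by
  have hw : wilsonWeight (d := d) (L := L) ρ 0 = trivialMeasure G d L := by
    rw [wilsonWeight]
    unfold trivialMeasure
    simp only [neg_zero, zero_mul, Real.exp_zero, ENNReal.ofReal_one]
    exact withDensity_one
  haveI : IsProbabilityMeasure (trivialMeasure G d L) := by unfold trivialMeasure; infer_instance
  rw [wilsonMeasure, partitionFunction, hw, measure_univ, inv_one, one_smul]

end Bookkeeping

/-! ## §2 The holomorphic logarithm of `Z_L` on the Kotecký–Preiss disc and its second derivative -/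

section LogZ

variable {d L n : ℕ} [NeZero L]

/-- The KP conditions at the closed-form radius `r(d, n)`: `r·M_{ρ₀} ≤ 1` and
`e·(2M_{ρ₀} r)·(3^d d² + 1)² ≤ ½` for the defining representation of `SU(n)`, `n ≥ 1`. [ours] -/
theorem kpRadius_conditions (hn : 1 ≤ n) :
    1 / (8 * Real.exp 1 * (n : ℝ) * ((3 : ℝ) ^ d * (d : ℝ) ^ 2 + 1) ^ 2) *
        costBound (StrongCoupling.defRep n) ≤ 1 ∧
      Real.exp 1 * (2 * costBound (StrongCoupling.defRep n) *
          (1 / (8 * Real.exp 1 * (n : ℝ) * ((3 : ℝ) ^ d * (d : ℝ) ^ 2 + 1) ^ 2))) *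
        ((Plaq.degBound d : ℝ) + 1) ^ 2 ≤ 1 / 2 := by
  set K : ℝ := ((3 : ℝ) ^ d * (d : ℝ) ^ 2 + 1) ^ 2 with hK
  have hn' : (1 : ℝ) ≤ n := by exact_mod_cast hn
  have hK1 : 1 ≤ K := by
    rw [hK]; nlinarith [show (0 : ℝ) ≤ (3 : ℝ) ^ d * (d : ℝ) ^ 2 by positivity]
  have he1 : 1 ≤ Real.exp 1 := Real.one_le_exp zero_le_one
  have hDK : ((Plaq.degBound d : ℝ) + 1) ^ 2 = K := by rw [cast_degBound]
  have hM : costBound (StrongCoupling.defRep n) ≤ 2 * n := by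
    have h := costBound_le_of_unitary (StrongCoupling.defRep n)
      (fun g => (Matrix.mem_specialUnitaryGroup_iff.1 g.2).1)
    rwa [max_eq_right (by linarith)] at h
  have hM0 : 0 < costBound (StrongCoupling.defRep n) := costBound_pos _
  have hpos : 0 < 8 * Real.exp 1 * (n : ℝ) * K := by positivity
  constructor
  · rw [div_mul_eq_mul_div, one_mul, div_le_one hpos]
    have heK : 1 ≤ Real.exp 1 * K := one_le_mul_of_one_le_of_one_le he1 hK1
    calc costBound (StrongCoupling.defRep n) ≤ 2 * n := hM
      _ ≤ 8 * Real.exp 1 * n * K := by nlinarith [heK, hn']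
  · rw [hDK]
    calc Real.exp 1 * (2 * costBound (StrongCoupling.defRep n) * (1 / (8 * Real.exp 1 * n * K))) * K
        ≤ Real.exp 1 * (2 * (2 * n) * (1 / (8 * Real.exp 1 * n * K))) * K := by gcongr
      _ = 1 / 2 := by field_simp; ring

/-- **The specific heat is `F″`.**  For every `n ≥ 1`, every `d`, `L` and every real `t` with
`|t| < r(d, n)`: the second derivative at `t` of the Kotecký–Preiss logarithm `F` of the torus plaquette
system (all genuine plaquettes on) is the variance of the Wilson action under `wilsonMeasure ρ₀ t`;
together with: `F` is holomorphic on `|s| < r` and bounded by `#plaq` there. [ours] -/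
theorem logZ_kp_package (hn : 1 ≤ n) :
    let r : ℝ := 1 / (8 * Real.exp 1 * (n : ℝ) * ((3 : ℝ) ^ d * (d : ℝ) ^ 2 + 1) ^ 2)
    let F : ℂ → ℂ := fun β => pertLogZ (zdHaar d (Matrix.specialUnitaryGroup (Fin n) ℂ))
      ((torusSystem (StrongCoupling.defRep n) L).weight β)
      (torusSystem (StrongCoupling.defRep n) L).Adj (torusGenuine d L)
    DifferentiableOn ℂ F (ball 0 r) ∧
      (∀ β ∈ ball (0 : ℂ) r, ‖F β‖ ≤ Fintype.card (Plaquette d L)) ∧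
      (∀ t : ℝ, |t| < r → iteratedDeriv 2 F (t : ℂ) =
        ((variance (wilsonAction (StrongCoupling.defRep n))
          (wilsonMeasure (d := d) (L := L) (StrongCoupling.defRep n) t) : ℝ) : ℂ)) := by
  classical
  intro r F
  set ρ₀ := StrongCoupling.defRep n with hρ₀
  have hρc : Continuous ρ₀ := continuous_subtype_val
  have hR := torusSystem_regular (d := d) (L := L) (G := Matrix.specialUnitaryGroup (Fin n) ℂ) ρ₀ hρc
  obtain ⟨h1, h2⟩ := kpRadius_conditions (d := d) hn
  have hr0 : 0 < r := kpRadius_pos (d := d) hn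
  have hM0 : 0 < costBound ρ₀ := costBound_pos _
  -- pointwise KP conditions on the ball
  have hball : ∀ β ∈ ball (0 : ℂ) r, ‖β‖ * costBound ρ₀ ≤ 1 ∧
      Real.exp 1 * (2 * costBound ρ₀ * ‖β‖) * ((Plaq.degBound d : ℝ) + 1) ^ 2 ≤ 1 / 2 := by
    intro β hβ
    rw [Metric.mem_ball, dist_zero_right] at hβ
    exact ⟨le_trans (by gcongr) h1, le_trans (by gcongr) h2⟩
  -- the Wilson partition function
  set Z := complexMGF (fun U => -ambWilsonAction (coeConfig U))
    (trivialMeasure (Matrix.specialUnitaryGroup (Fin n) ℂ) d L) with hZdef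
  have hZd : Differentiable ℂ Z := differentiable_actionZ contDiff_ambWilsonAction
  have hZeq : complexMGF (fun U => -wilsonAction ρ₀ U)
      (trivialMeasure (Matrix.specialUnitaryGroup (Fin n) ℂ) d L) = Z := by
    rw [hZdef]
    congr 1
    funext U
    rw [StrongCoupling.ambWilsonAction_coeConfig]
  -- (a) holomorphy
  have hFd : DifferentiableOn ℂ F (ball 0 r) := PlaqSystem.differentiableOn_pertLogZ hR h1 h2 _
  -- (b) the Kotecký–Preiss bound
  have hFb : ∀ β ∈ ball (0 : ℂ) r, ‖F β‖ ≤ Fintype.card (Plaquette d L) := fun β hβ => by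
    have h := PlaqSystem.norm_pertLogZ_le_card hR (hball β hβ).1 (hball β hβ).2 (torusGenuine d L)
    rw [card_torusGenuine] at h
    exact h
  -- (c) `exp F = Z` on the ball, hence `F' = Z'/Z` there
  have hFexp : ∀ β ∈ ball (0 : ℂ) r, cexp (F β) = Z β := fun β hβ => by
    rw [PlaqSystem.exp_pertLogZ_eq_partZ hR (hball β hβ).1 (hball β hβ).2,
      torusSystem_partZ_genuine_eq_complexMGF ρ₀ hρc, hZeq]
  have hZne : ∀ β ∈ ball (0 : ℂ) r, Z β ≠ 0 := fun β hβ => by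
    rw [← hFexp β hβ]; exact Complex.exp_ne_zero _
  have hF' : ∀ β ∈ ball (0 : ℂ) r, deriv F β = deriv Z β / Z β := by
    intro β hβ
    have hFβ : HasDerivAt F (deriv F β) β :=
      (hFd.differentiableAt (isOpen_ball.mem_nhds hβ)).hasDerivAt
    have hexpF : HasDerivAt (fun z => cexp (F z)) (cexp (F β) * deriv F β) β := hFβ.cexp
    have hev : (fun z => cexp (F z)) =ᶠ[𝓝 β] Z :=
      Filter.eventually_of_mem (isOpen_ball.mem_nhds hβ) fun z hz => hFexp z hz
    have hZβ : HasDerivAt Z (cexp (F β) * deriv F β) β := hexpF.congr_of_eventuallyEq hev.symm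
    rw [hZβ.deriv, hFexp β hβ, mul_div_cancel_left₀ _ (hZne β hβ)]
  -- (d) `F'' = (Z'/Z)'` on the ball
  have hF'' : ∀ β ∈ ball (0 : ℂ) r,
      iteratedDeriv 2 F β = deriv (fun w => deriv Z w / Z w) β := by
    intro β hβ
    rw [iteratedDeriv_succ, iteratedDeriv_one]
    refine Filter.EventuallyEq.deriv_eq ?_
    exact Filter.eventually_of_mem (isOpen_ball.mem_nhds hβ) fun z hz => hF' z hz
  refine ⟨hFd, hFb, fun t ht => ?_⟩
  have htball : (t : ℂ) ∈ ball (0 : ℂ) r := by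
    rw [Metric.mem_ball, dist_zero_right, Complex.norm_real, Real.norm_eq_abs]; exact ht
  rw [hF'' t htball, hZdef,
    deriv_logDeriv_actionZ_ofReal_eq_variance (d := d) (L := L) (n := n) contDiff_ambWilsonAction t,
    StrongCoupling.boltzmannMeasure_smul_ambWilsonAction t]
  simp_rw [StrongCoupling.ambWilsonAction_coeConfig]
  rfl

/-- **VOLUME-UNIFORM STRONG-COUPLING EXPANSION OF THE SPECIFIC HEAT.**  For every `d`, `n ≥ 2`, EVERY
`L ≥ 2` and every real coupling `x` with `|x| < r/4`, `r = 1/(8e·n·(3^d d² + 1)²)`: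
`|Var_x(S_W) − m₂(n)·#plaq| ≤ 256 · #plaq · |x| / r³` (`m₂(n) = ∫_{SU(n)} (Re tr)² dHaar`; variance
under `wilsonMeasure ρ₀ x`). [ours] -/
theorem wilson_variance_sub_le_strongCoupling (hn : 2 ≤ n) (hL : 2 ≤ L) (x : ℝ)
    (hx : |x| < 1 / (8 * Real.exp 1 * (n : ℝ) * ((3 : ℝ) ^ d * (d : ℝ) ^ 2 + 1) ^ 2) / 4) :
    |variance (wilsonAction (StrongCoupling.defRep n))
          (wilsonMeasure (d := d) (L := L) (StrongCoupling.defRep n) x) -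
        (∫ g, ((g : Matrix (Fin n) (Fin n) ℂ)).trace.re ^ 2
          ∂(haarProbability (Matrix.specialUnitaryGroup (Fin n) ℂ))) * Fintype.card (Plaquette d L)| ≤
      256 * Fintype.card (Plaquette d L) * |x| /
        (1 / (8 * Real.exp 1 * (n : ℝ) * ((3 : ℝ) ^ d * (d : ℝ) ^ 2 + 1) ^ 2)) ^ 3 := by
  classical
  set r : ℝ := 1 / (8 * Real.exp 1 * (n : ℝ) * ((3 : ℝ) ^ d * (d : ℝ) ^ 2 + 1) ^ 2) with hr
  set P : ℝ := (Fintype.card (Plaquette d L) : ℝ) with hP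
  set ρ₀ := StrongCoupling.defRep n with hρ₀
  set F : ℂ → ℂ := fun β => pertLogZ (zdHaar d (Matrix.specialUnitaryGroup (Fin n) ℂ))
      ((torusSystem (StrongCoupling.defRep n) L).weight β)
      (torusSystem (StrongCoupling.defRep n) L).Adj (torusGenuine d L) with hF
  obtain ⟨hFd, hFb, hFvar⟩ := logZ_kp_package (d := d) (L := L) (n := n) (by omega)
  have hr0 : 0 < r := kpRadius_pos (d := d) (by omega)
  have hP0 : 0 ≤ P := by rw [hP]; positivity
  -- `F''` is holomorphic on the ball and bounded by `32 P / r²` on the half ball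
  have hF1d : DifferentiableOn ℂ (deriv F) (ball 0 r) := hFd.deriv isOpen_ball
  have hF2d : DifferentiableOn ℂ (iteratedDeriv 2 F) (ball 0 r) := by
    rw [iteratedDeriv_succ, iteratedDeriv_one]; exact hF1d.deriv isOpen_ball
  have hF2b : ∀ z ∈ ball (0 : ℂ) (r / 2), ‖iteratedDeriv 2 F z‖ ≤ 32 * P / r ^ 2 := by
    intro z hz
    rw [Metric.mem_ball, dist_zero_right] at hz
    have hsub : ball z (r / 2) ⊆ ball 0 r := by
      intro u hu
      rw [Metric.mem_ball, dist_zero_right]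
      rw [Metric.mem_ball] at hu
      calc ‖u‖ = ‖(u - z) + z‖ := by rw [sub_add_cancel]
        _ ≤ ‖u - z‖ + ‖z‖ := norm_add_le _ _
        _ < r / 2 + r / 2 := by rw [← dist_eq_norm]; exact add_lt_add hu hz
        _ = r := by ring
    have h := norm_iteratedDeriv_le_of_forall_mem_ball (f := F) (c := z) (R := r / 2) (M := P)
      (by positivity) (hFd.mono hsub) (fun u hu => hFb u (hsub hu)) 2
    refine h.trans (le_of_eq ?_)
    simp only [Nat.factorial_two, Nat.cast_ofNat]
    field_simp
    ring
  -- Lipschitz bound on `ball 0 (r/4)` between `x` and `0`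
  have hxball : (x : ℂ) ∈ ball (0 : ℂ) (r / 2 / 2) := by
    rw [Metric.mem_ball, dist_zero_right, Complex.norm_real, Real.norm_eq_abs]
    linarith
  have h0ball : (0 : ℂ) ∈ ball (0 : ℂ) (r / 2 / 2) := mem_ball_self (by positivity)
  have hlip := norm_sub_le_mul_of_forall_mem_ball (f := iteratedDeriv 2 F) (c := 0) (R := r / 2)
    (M := 32 * P / r ^ 2) (by positivity) (hF2d.mono (ball_subset_ball (by linarith))) hF2b
    hxball h0ball
  -- identify the two values of `F''`
  have hx' : |x| < r := by linarith
  have hF0 : iteratedDeriv 2 F 0 =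
      ((variance (wilsonAction ρ₀) (wilsonMeasure (d := d) (L := L) ρ₀ 0) : ℝ) : ℂ) := by
    have h := hFvar 0 (by rw [abs_zero]; exact hr0)
    rwa [Complex.ofReal_zero] at h
  -- the value at `0`
  have hvar0 : variance (wilsonAction ρ₀) (wilsonMeasure (d := d) (L := L) ρ₀ 0) =
      (∫ g, ((g : Matrix (Fin n) (Fin n) ℂ)).trace.re ^ 2
        ∂(haarProbability (Matrix.specialUnitaryGroup (Fin n) ℂ))) * P := by
    rw [wilsonMeasure_zero_eq_trivialMeasure, hP, ← wilson_variance_eq (d := d) hL hn]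
    congr 1
    funext U
    rw [StrongCoupling.ambWilsonAction_coeConfig]
  rw [hFvar x hx', hF0, hvar0, sub_zero, Complex.norm_real, Real.norm_eq_abs, ← Complex.ofReal_sub,
    Complex.norm_real, Real.norm_eq_abs] at hlip
  have hr0' : r ≠ 0 := hr0.ne'
  refine hlip.trans (le_of_eq ?_)
  field_simp
  ring

/-- **NO VOLUME-DIVERGENCE OF THE SPECIFIC HEAT AT STRONG COUPLING**: for every `d`, `n ≥ 1`, EVERY `L`
and every real `x` with `|x| < r/2`: `Var_x(S_W) ≤ 32 · #plaq / r²`. [ours] -/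
theorem wilson_variance_le_strongCoupling (hn : 1 ≤ n) (x : ℝ)
    (hx : |x| < 1 / (8 * Real.exp 1 * (n : ℝ) * ((3 : ℝ) ^ d * (d : ℝ) ^ 2 + 1) ^ 2) / 2) :
    variance (wilsonAction (StrongCoupling.defRep n))
        (wilsonMeasure (d := d) (L := L) (StrongCoupling.defRep n) x) ≤
      32 * Fintype.card (Plaquette d L) /
        (1 / (8 * Real.exp 1 * (n : ℝ) * ((3 : ℝ) ^ d * (d : ℝ) ^ 2 + 1) ^ 2)) ^ 2 := by
  classical
  set r : ℝ := 1 / (8 * Real.exp 1 * (n : ℝ) * ((3 : ℝ) ^ d * (d : ℝ) ^ 2 + 1) ^ 2) with hr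
  set P : ℝ := (Fintype.card (Plaquette d L) : ℝ) with hP
  set F : ℂ → ℂ := fun β => pertLogZ (zdHaar d (Matrix.specialUnitaryGroup (Fin n) ℂ))
      ((torusSystem (StrongCoupling.defRep n) L).weight β)
      (torusSystem (StrongCoupling.defRep n) L).Adj (torusGenuine d L) with hF
  obtain ⟨hFd, hFb, hFvar⟩ := logZ_kp_package (d := d) (L := L) (n := n) hn
  have hr0 : 0 < r := kpRadius_pos (d := d) hn
  have hxr : |x| < r := by linarith
  have hsub : ball (x : ℂ) (r / 2) ⊆ ball 0 r := by
    intro u hu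
    rw [Metric.mem_ball, dist_zero_right]
    rw [Metric.mem_ball, dist_eq_norm] at hu
    have hxn : ‖(x : ℂ)‖ < r / 2 := by rw [Complex.norm_real, Real.norm_eq_abs]; exact hx
    calc ‖u‖ = ‖(u - x) + x‖ := by rw [sub_add_cancel]
      _ ≤ ‖u - (x : ℂ)‖ + ‖(x : ℂ)‖ := norm_add_le _ _
      _ < r / 2 + r / 2 := add_lt_add hu hxn
      _ = r := by ring
  have h := norm_iteratedDeriv_le_of_forall_mem_ball (f := F) (c := (x : ℂ)) (R := r / 2) (M := P)
    (by positivity) (hFd.mono hsub) (fun u hu => hFb u (hsub hu)) 2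
  rw [hFvar x hxr, Complex.norm_real, Real.norm_eq_abs, abs_of_nonneg (variance_nonneg _ _)] at h
  refine h.trans (le_of_eq ?_)
  simp only [Nat.factorial_two, Nat.cast_ofNat]
  field_simp
  ring

end LogZ

/-! ## §3 The specific-heat floor and Fisher zeros near every strong-coupling point -/

section Floor

variable {d L n : ℕ} [NeZero L]

/-- **SPECIFIC-HEAT FLOOR AT STRONG COUPLING, EVERY VOLUME**: for `n ≥ 2`, `L ≥ 2` and
`|x| ≤ min (r/8) (m₂(n)·r³/512)`: `Var_x(S_W) ≥ m₂(n)·#plaq / 2`. [ours] -/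
theorem wilson_variance_ge_half_strongCoupling (hn : 2 ≤ n) (hL : 2 ≤ L) (x : ℝ)
    (hx : |x| ≤ min (1 / (8 * Real.exp 1 * (n : ℝ) * ((3 : ℝ) ^ d * (d : ℝ) ^ 2 + 1) ^ 2) / 8)
      ((∫ g, ((g : Matrix (Fin n) (Fin n) ℂ)).trace.re ^ 2
          ∂(haarProbability (Matrix.specialUnitaryGroup (Fin n) ℂ))) *
        (1 / (8 * Real.exp 1 * (n : ℝ) * ((3 : ℝ) ^ d * (d : ℝ) ^ 2 + 1) ^ 2)) ^ 3 / 512)) :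
    (∫ g, ((g : Matrix (Fin n) (Fin n) ℂ)).trace.re ^ 2
        ∂(haarProbability (Matrix.specialUnitaryGroup (Fin n) ℂ))) * Fintype.card (Plaquette d L) / 2 ≤
      variance (wilsonAction (StrongCoupling.defRep n))
        (wilsonMeasure (d := d) (L := L) (StrongCoupling.defRep n) x) := by
  set r : ℝ := 1 / (8 * Real.exp 1 * (n : ℝ) * ((3 : ℝ) ^ d * (d : ℝ) ^ 2 + 1) ^ 2) with hr
  set P : ℝ := (Fintype.card (Plaquette d L) : ℝ) with hP
  set m₂ := ∫ g, ((g : Matrix (Fin n) (Fin n) ℂ)).trace.re ^ 2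
    ∂(haarProbability (Matrix.specialUnitaryGroup (Fin n) ℂ)) with hm₂
  have hr0 : 0 < r := kpRadius_pos (d := d) (by omega)
  have hP0 : 0 ≤ P := by rw [hP]; positivity
  have hx1 : |x| ≤ r / 8 := hx.trans (min_le_left _ _)
  have hx2 : |x| ≤ m₂ * r ^ 3 / 512 := hx.trans (min_le_right _ _)
  have h := wilson_variance_sub_le_strongCoupling (d := d) (L := L) hn hL x (by linarith)
  rw [← hr, ← hP, ← hm₂] at h
  have h' := (abs_sub_le_iff.1 h).2
  -- `256 P |x| / r³ ≤ m₂ P / 2`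
  have hkey : 256 * P * |x| / r ^ 3 ≤ m₂ * P / 2 := by
    rw [div_le_iff₀ (by positivity)]
    have : 256 * |x| ≤ m₂ * r ^ 3 / 2 := by linarith
    nlinarith
  linarith

/-- **A FISHER ZERO WITHIN `8n/m₂(n)` OF EVERY STRONG-COUPLING POINT, EVERY VOLUME**: for `d ≥ 2`,
`n ≥ 2`, EVERY `L ≥ 2` and every real `x` with `|x| ≤ min (r/8) (m₂(n)·r³/512)`:
`dist(x, F_{Z_L}) ≤ 8n / m₂(n)` (`16` for `SU(2)`, `16n` for `n ≥ 3`). [ours] -/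
theorem wilson_infDist_zeroSet_le_strongCoupling (hd : 2 ≤ d) (hn : 2 ≤ n) (hL : 2 ≤ L) (x : ℝ)
    (hx : |x| ≤ min (1 / (8 * Real.exp 1 * (n : ℝ) * ((3 : ℝ) ^ d * (d : ℝ) ^ 2 + 1) ^ 2) / 8)
      ((∫ g, ((g : Matrix (Fin n) (Fin n) ℂ)).trace.re ^ 2
          ∂(haarProbability (Matrix.specialUnitaryGroup (Fin n) ℂ))) *
        (1 / (8 * Real.exp 1 * (n : ℝ) * ((3 : ℝ) ^ d * (d : ℝ) ^ 2 + 1) ^ 2)) ^ 3 / 512)) :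
    infDist (x : ℂ) {s : ℂ | complexMGF (fun U => -ambWilsonAction (coeConfig U))
      (trivialMeasure (Matrix.specialUnitaryGroup (Fin n) ℂ) d L) s = 0} ≤
      8 * n / ∫ g, ((g : Matrix (Fin n) (Fin n) ℂ)).trace.re ^ 2
          ∂(haarProbability (Matrix.specialUnitaryGroup (Fin n) ℂ)) := by
  set m₂ := ∫ g, ((g : Matrix (Fin n) (Fin n) ℂ)).trace.re ^ 2
    ∂(haarProbability (Matrix.specialUnitaryGroup (Fin n) ℂ)) with hm₂
  set P : ℝ := (Fintype.card (Plaquette d L) : ℝ) with hP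
  have hm : 0 < m₂ := haarSqReTrace_pos (by omega)
  have hP1 : 1 ≤ P := by rw [hP]; exact_mod_cast WilsonPinching.one_le_card_plaquette hd
  have hfloor := wilson_variance_ge_half_strongCoupling (d := d) (L := L) hn hL x hx
  rw [← hm₂, ← hP] at hfloor
  have hvpos : 0 < variance (wilsonAction (StrongCoupling.defRep n))
      (wilsonMeasure (d := d) (L := L) (StrongCoupling.defRep n) x) :=
    lt_of_lt_of_le (by positivity) hfloor
  refine (wilson_infDist_zeroSet_le (d := d) (L := L) (n := n) x hvpos).trans ?_
  rw [← hP, div_le_div_iff₀ hvpos hm]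
  nlinarith

/-- **`SU(2)`** (`m₂ = 1`): `dist(x, F_{Z_L}) ≤ 16` for `|x| ≤ min (r/8) (r³/512)`, `r = r(d, 2)`,
every `d ≥ 2`, `L ≥ 2`. [ours] -/
theorem wilson_su2_infDist_zeroSet_le_strongCoupling (hd : 2 ≤ d) (hL : 2 ≤ L) (x : ℝ)
    (hx : |x| ≤ min (1 / (8 * Real.exp 1 * (2 : ℝ) * ((3 : ℝ) ^ d * (d : ℝ) ^ 2 + 1) ^ 2) / 8)
      ((1 / (8 * Real.exp 1 * (2 : ℝ) * ((3 : ℝ) ^ d * (d : ℝ) ^ 2 + 1) ^ 2)) ^ 3 / 512)) :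
    infDist (x : ℂ) {s : ℂ | complexMGF (fun U => -ambWilsonAction (coeConfig U))
      (trivialMeasure (Matrix.specialUnitaryGroup (Fin 2) ℂ) d L) s = 0} ≤ 16 := by
  have h := wilson_infDist_zeroSet_le_strongCoupling (d := d) (L := L) (n := 2) hd le_rfl hL x
    (by rw [haarSqReTrace_su2, one_mul]; exact_mod_cast hx)
  rw [haarSqReTrace_su2] at h
  norm_num at h
  exact h

end Floor

end Summit.Ventures.LatticeQCDFlow.TrivializingMaps
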